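import Summits.Schanuel.Schanuel.Theorems.ZilberEacGraphBinomialComplete
import Summits.Schanuel.Schanuel.Theorems.ZilberEacGraphRows
import Summits.Schanuel.Schanuel.Theorems.ZilberEacQuadraticDiscriminant
import HarnessLib

/-!
# The equimodular class, XXXIX: the residual of Mantova–Masser's question over polynomial graphs
# after THEOREM EB and the quadratic theorem

HONEST FRAMING.  Cell `pub-schanuel` (Zilber's Exponential-Algebraic Closedness, case ladder;
host summit Schanuel), seat 2, gen 24.  **`mmCase_graphBase_residual_simpleTopRow`**: let
`W ⊆ ℂ² × (ℂˣ)²` be in Mantova–Masser's case over the polynomial graph `x₁ = p(x₀)`, `deg p ≥ 2`, and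
suppose its exponential points are NOT Zariski dense.  Then, in addition to everything in gen 23's
residual (`mmCase_graphBase_residual_twoPositiveDegrees`: `W = {x₁ = p(x₀), P₂ = 0}` with an
irreducible equimodular fibre curve `P₂`), EITHER `P₂ ∈ ℂ[y₀]` (a constant, non-free fibre) OR `P₂` has
two distinct positive `y₀`-degrees AND, with `N₀` the largest `x₀`-degree and `r` the largest
`y₀`-degree: the top row `Σ_{v₀ = N₀} P_v X^{v₁}` is NOT separable (a multiple root: ramified
branches at infinity), or `r ≥ 3` and the extreme rows are proportional (`Σ_{v₁ = 0} P_v X^{v₀} =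
c · Σ_{v₁ = r} P_v X^{v₀}`).  Proof: otherwise THEOREM EB (file XXIX) or, for `r = 2`, the
quadratic theorem (file XXXVII) decides density, through the rows bridge (file XXXVIII).  An OPEN
question in general (Mantova–Masser, PLMS 2024 §1 p. 5); EC(3,2) OPEN; NOT Schanuel's conjecture
(neither used nor implied; EAC ⇏ SC).
-/

noncomputable section

open Filter Topology Set Complex MvPolynomial
open Literature.NumberTheory.Transcendental Literature.ModelTheory.Zilber
open Literature.ModelTheory.ExponentialFields

set_option linter.dupNamespace false

namespace Summit.Schanuel.Schanuel.Theorems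

section Residual

variable (p : Polynomial ℂ)

/-- **The residual over polynomial graphs after gen 24.**  See the module docstring.
[cite: MantovaMasser2023, §1 Further remarks, p. 5 (the question, open in general)] (new) -/
theorem mmCase_graphBase_residual_simpleTopRow (hd : 2 ≤ p.natDegree)
    {W : Set (Fin 2 ⊕ Fin 2 → ℂ)} (hmm : MMCaseDimPiOneFree W)
    (hbase : zeroLocus ℂ (vanishingIdeal ℂ (projAdd '' (W ∩ torusLocus ℂ 2))) =
      {x : Fin 2 → ℂ | x 1 = p.eval (x 0)})
    (hnot : ¬ UnprojectedDense W) :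
    ∃ P₂ : MvPolynomial (Fin 2) ℂ, Irreducible P₂ ∧
      (∃ v ∈ P₂.support, ∃ v' ∈ P₂.support, v 1 ≠ v' 1) ∧
      W = {w : Fin 2 ⊕ Fin 2 → ℂ | w (Sum.inl 1) = p.eval (w (Sum.inl 0)) ∧
        MvPolynomial.eval ![w (Sum.inl 0), w (Sum.inr 0)] P₂ = 0} ∧
      (p.leadingCoeff * I ^ p.natDegree).re = 0 ∧
      (∀ v₀ ∈ P₂.support, (∀ v ∈ P₂.support, v 0 ≤ v₀ 0) →
        (∃ vR ∈ P₂.support, vR 0 = v₀ 0 ∧ ∀ u ∈ P₂.support, u 1 ≤ vR 1) ∧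
        (∃ vL ∈ P₂.support, vL 0 = v₀ 0 ∧ ∀ u ∈ P₂.support, vL 1 ≤ u 1)) ∧
      (∀ N₀ : ℕ, (∀ v ∈ P₂.support, v 0 ≤ N₀) → ∀ va ∈ P₂.support, ∀ vc ∈ P₂.support,
        va 0 = N₀ → vc 0 = N₀ → va 1 ≠ vc 1 → ∀ θ : ℂ, θ ≠ 0 →
        (∑ v ∈ P₂.support.filter (fun v : Fin 2 →₀ ℕ => v 0 = N₀),
          Polynomial.C (P₂.coeff v) * Polynomial.X ^ (v 1)).eval θ = 0 →
        (p.natDegree : ℝ) * (p.leadingCoeff * I ^ (p.natDegree - 1)).re * Real.log ‖θ‖ +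
          (p.coeff (p.natDegree - 1) * I ^ (p.natDegree - 1)).re = 0) ∧
      (((∃ v ∈ P₂.support, ∃ v' ∈ P₂.support, 0 < v 1 ∧ 0 < v' 1 ∧ v 1 ≠ v' 1) ∧
        ∀ N₀ r : ℕ, (∀ v ∈ P₂.support, v 0 ≤ N₀) → (∃ v ∈ P₂.support, v 0 = N₀) →
          (∀ v ∈ P₂.support, v 1 ≤ r) → (∃ v ∈ P₂.support, v 1 = r) →
          ¬ (∑ v ∈ P₂.support.filter (fun v : Fin 2 →₀ ℕ => v 0 = N₀),
              Polynomial.C (P₂.coeff v) * Polynomial.X ^ (v 1)).Separable ∨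
          (3 ≤ r ∧ ∃ c : ℂ,
            (∑ v ∈ P₂.support.filter (fun v : Fin 2 →₀ ℕ => v 1 = 0),
              Polynomial.C (P₂.coeff v) * Polynomial.X ^ (v 0)) =
            Polynomial.C c * ∑ v ∈ P₂.support.filter (fun v : Fin 2 →₀ ℕ => v 1 = r),
              Polynomial.C (P₂.coeff v) * Polynomial.X ^ (v 0))) ∨
        (∀ v ∈ P₂.support, v 0 = 0)) := by
  classical
  obtain ⟨P₂, hirr₂, h1, hW₂, hre, hrow, hroot, hdisj⟩ :=
    mmCase_graphBase_residual_twoPositiveDegrees p hd hmm hbase hnot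
  refine ⟨P₂, hirr₂, h1, hW₂, hre, hrow, hroot, ?_⟩
  rcases hdisj with hpos | hconst
  swap
  · exact Or.inr hconst
  by_cases hconst : ∀ v ∈ P₂.support, v 0 = 0
  · exact Or.inr hconst
  refine Or.inl ⟨hpos, fun N₀ r hN hNex hr hrex => ?_⟩
  by_contra hneg
  push Not at hneg
  obtain ⟨hsep, hneg3⟩ := hneg
  -- the rows
  set Q : Polynomial (Polynomial ℂ) :=
    ∑ v ∈ P₂.support, Polynomial.monomial (v 1) (Polynomial.monomial (v 0) (P₂.coeff v)) with hQ
  set T : Polynomial ℂ := ∑ v ∈ P₂.support.filter (fun v : Fin 2 →₀ ℕ => v 0 = N₀),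
    Polynomial.C (P₂.coeff v) * Polynomial.X ^ (v 1) with hTdef
  have hPQ : ∀ x y : ℂ, MvPolynomial.eval ![x, y] P₂ = (Q.map (Polynomial.evalRingHom x)).eval y :=
    fun x y => eval_eq_rowsPP P₂ x y
  have hNQ : ∀ j, (Q.coeff j).natDegree ≤ N₀ := fun j => natDegree_coeff_rowsPP_le P₂ hN j
  have hQdeg : Q.natDegree = r := natDegree_rowsPP_eq P₂ hr hrex
  have hT : ∀ j, T.coeff j = (Q.coeff j).coeff N₀ := fun j => coeff_topRowSum_eq_coeff_coeff_rowsPP P₂ N₀ j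
  have hTcoeff : ∀ j, T.coeff j = P₂.coeff (Finsupp.single 0 N₀ + Finsupp.single 1 j) :=
    fun j => coeff_topRowSum P₂ N₀ j
  -- the extreme monomials of the top row
  obtain ⟨v₀, hv₀, hv₀N⟩ := hNex
  obtain ⟨⟨vR, hvR, hvR0, hvRmax⟩, ⟨vL, hvL, hvL0, hvLmin⟩⟩ := hrow v₀ hv₀ (by rw [hv₀N]; exact hN)
  rw [hv₀N] at hvR0 hvL0
  have hvR1 : vR 1 = r := by
    obtain ⟨v, hv, hvr⟩ := hrex
    exact le_antisymm (hr vR hvR) (hvr ▸ hvRmax v hv)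
  obtain ⟨u, hu, hu1⟩ := exists_support_snd_eq_zero_of_irreducible P₂ hirr₂ h1
  have hvL1 : vL 1 = 0 := Nat.le_zero.1 (hu1 ▸ hvLmin u hu)
  have hTr : T.coeff r ≠ 0 := by
    rw [hTcoeff, ← hvR0, ← hvR1, ← Literature.NumberTheory.EllipticCurves.finsupp_fin_two_eq vR]
    exact MvPolynomial.mem_support_iff.1 hvR
  have hT0c : T.coeff 0 ≠ 0 := by
    rw [hTcoeff, ← hvL0, ← hvL1, ← Literature.NumberTheory.EllipticCurves.finsupp_fin_two_eq vL]
    exact MvPolynomial.mem_support_iff.1 hvL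
  have hTdeg : T.natDegree = r := by
    refine le_antisymm ?_ (Polynomial.le_natDegree_of_ne_zero hTr)
    rw [Polynomial.natDegree_le_iff_coeff_eq_zero]
    intro j hj
    rw [hTcoeff]
    refine MvPolynomial.notMem_support_iff.1 fun h => ?_
    have := hr _ h
    simp at this
    have hj' : r < j := by exact_mod_cast hj
    omega
  have hT00 : T.eval 0 ≠ 0 := by rwa [← Polynomial.coeff_zero_eq_eval_zero]
  have hN1 : 1 ≤ N₀ := by
    push Not at hconst
    obtain ⟨v, hv, hv0⟩ := hconst
    have := hN v hv
    omega
  -- the surface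
  have hWeq : W = {w : Fin 2 ⊕ Fin 2 → ℂ | w (Sum.inl 1) = p.eval (w (Sum.inl 0)) ∧
      MvPolynomial.eval ![w (Sum.inl 0), w (Sum.inr 0)] P₂ = 0} := hW₂
  apply hnot
  rw [hWeq]
  by_cases hprop : ∃ c : ℂ,
      (∑ v ∈ P₂.support.filter (fun v : Fin 2 →₀ ℕ => v 1 = 0),
        Polynomial.C (P₂.coeff v) * Polynomial.X ^ (v 0)) =
      Polynomial.C c * ∑ v ∈ P₂.support.filter (fun v : Fin 2 →₀ ℕ => v 1 = r),
        Polynomial.C (P₂.coeff v) * Polynomial.X ^ (v 0)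
  · -- proportional extreme rows: then `r ≤ 2`, hence `r = 2`: the quadratic theorem
    have hr2 : r ≤ 2 := by
      by_contra h
      obtain ⟨c, hc⟩ := hprop
      exact hneg3 (by omega) c hc
    obtain ⟨va, hva, vb, hvb, hva1, hvb1, hab⟩ := hpos
    have hr2' : r = 2 := by
      have ha := hr va hva
      have hb := hr vb hvb
      omega
    -- `P₂` in `q`-form
    have hP' : ∀ x y : ℂ, MvPolynomial.eval ![x, y] P₂ =
        (Q.coeff 2).eval x * y ^ 2 + (Q.coeff 1).eval x * y + (Q.coeff 0).eval x := by
      intro x y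
      rw [hPQ, evalPP_eq_sum Q x y (by rw [hQdeg, hr2']; norm_num : Q.natDegree < 3)]
      simp only [Finset.sum_range_succ, Finset.sum_range_zero, zero_add, pow_zero, mul_one, pow_one]
      ring
    have hTform : T = Polynomial.C ((Q.coeff 2).coeff N₀) * Polynomial.X ^ 2 +
        Polynomial.C ((Q.coeff 1).coeff N₀) * Polynomial.X + Polynomial.C ((Q.coeff 0).coeff N₀) := by
      ext j
      simp only [Polynomial.coeff_add, Polynomial.coeff_C_mul, Polynomial.coeff_X_pow, Polynomial.coeff_X,
        Polynomial.coeff_C]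
      rcases j with _ | _ | _ | j
      · simp [hT]
      · simp [hT]
      · simp [hT]
      · have : T.coeff (j + 3) = 0 :=
          Polynomial.coeff_eq_zero_of_natDegree_lt (by rw [hTdeg, hr2']; omega)
        simp [this]
    have ht₂ : (Q.coeff 2).coeff N₀ ≠ 0 := by rw [← hT, ← hr2']; exact hTr
    have ht₀ : (Q.coeff 0).coeff N₀ ≠ 0 := by rw [← hT]; exact hT0c
    have hsep' := hsep
    rw [hTform] at hsep'
    exact unprojectedDense_graph_quadraticFibre' (Q.coeff 0) (Q.coeff 1) (Q.coeff 2) hP' hirr₂ N₀ hN1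
      (hNQ 2) (hNQ 1) (hNQ 0) ht₂ ht₀ hsep' p hd
  · -- non-proportional extreme rows: THEOREM EB
    have hratio : ∀ c : ℂ, Q.coeff 0 ≠ Polynomial.C c * Q.coeff Q.natDegree := by
      intro c h
      apply hprop
      refine ⟨c, ?_⟩
      rw [rowSum_eq_coeff_rowsPP, rowSum_eq_coeff_rowsPP, ← hQdeg]
      exact h
    exact unprojectedDense_graph_simpleTopRow Q hPQ hirr₂ N₀ hNQ T hT (by rw [hTdeg, hQdeg]) hsep hT00
      hratio p hd

end Residual

end Summit.Schanuel.Schanuel.Theorems
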